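import Summits.QuantumFields.BalabanUV.Beta.GAN24.SlavedSummandLetterDriftRows
import Summits.QuantumFields.BalabanUV.Beta.GAN24.BlockCommutatorStepLetter

/-!
# `BalabanUV.Beta.GAN24.BlockCommutatorStepLetterDrift` — binder row G-an2-4 ∕ (CONV-C), W-slot EXIT (α) (RULING R-lead-g77-1 (2); the (α-0) parity re-cut, piece (α-END-b′) —
# the even member's cell DRIFT row `hcelld`, SLOT half): **THE DRIFT TWIN OF `BlockCommutatorStepLetter` — the rows `hEd₁ ∕ hEd₂` of leaf-01 g72's PART 6a ∕ 6b
# `HalfMemberSlavedDivergenceDrift{,Snd}` (the one-step DIFFERENCE of the slaved `e3OfK` summand tables at two consecutive levels) AT `ε = 1`, UNIFORMLY IN THE LEVEL WITH A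
# GEOMETRIC RATE, from the dressed-K uniform ∧ Cauchy rows, «S′Shape» ∧ «S′Cauchy», and two scalar rows; the `d = 3` discharge modulo the scalar rows** — PART 2 (the
# level instance; PART 1 = `GAN24/SlavedSummandLetterDriftRows`, the generic one-step difference rows)
# (road-P2 chair of row G-an2-4, unit `b2b-balaban-gan24-p2` gen 45, crux team (2); leaf-01 g72's located row (ii′), A-5 l.51007: «the drift twin of p2's INTENT 2 —
# `K_{l+1} − K_l` from `hKall`, `S_{l+1} − S_l` from `hSall`, the lock scalars' difference, the units' ratio; first refusal p2 g45»)

NOT IN PRINT; OUR BOOKKEEPING ([folklore] kernel algebra + composition BY NAME; 0 `def`, 0 cited facts, 0 `def … : Prop`, 0 sorry).  HONEST FRAMING (cell contract,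
verbatim): «discharging `BetaPertH` makes Bałaban's UV stability UNCONDITIONAL — a real constructive-QFT result; it is NOT the continuum limit and NOT the Clay problem.»
HONEST DEPENDENCY (verbatim): «continuum YM on T⁴ ⇐ BetaPertH ∧ nine spine estimates (0/9 proved); BetaPertH ⇐ (D1) ∧ (D4) ∧ CAP+tail; G-an2-4 gates asym, D1 and
NE2/3/4.»

WHAT (objects as in `BlockCommutatorStepLetter`: dressed unit step resolvents `K♮ᴱ_l = unitK_l (coDressKBmAt ρ Lc (KInvStep Lc l))`, unit first-order tables
`S′_l = unitS_l (SpureRecAt d Lc ρ cE cVH cΛ l)`, block generators `X p = diagK (½ • Σ_{v ∈ box} legInd ρ (Lc • p + v))`, scalars `q_l = (sf_l·sm_l)⁻¹·(cH l)⁻¹`; leaf-03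
g15's three-leg third jet `e3K3 X Y Z N S` (`ThirdJetThreeKernel`), whose diagonal is `e3OfK N K S` by `rfl`):
* PART 1 §1 (generic `d`) **`abs_e3K3_commFactor_le`** — leaf-03 g66's TWO-CENTRE BOUND `abs_e3OfK_commFactor_le` with the three kernel legs KEPT APART (her proof token for token;
  `Decays X ∕ Y ∕ Z` used each at its own leg: `biLoc_comp_decays` ∕ `vertexFamily_vertexOfK` ∕ `biLoc_comp_right`), constant `CX·CY·CZ·CF·|c₀|·Ψ(m)`;
  `locStencil_commFactor` (a factor-form family is a local stencil family, constant `2|c₀|·cg·CF`); `abs_le_of_locStencil`.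
* PART 1 §2 `rows_of_twoCentre` — her recentring abstracted: a two-centre bound gives BOTH the passive `(_, p, κ′, u′)` and the active `(κ, u, _, p)` `LocStencil₂` rows.
* PART 1 §3 **`abs_e3OfK_commFactor_sub_le`** — THE ONE-STEP DIFFERENCE, ENTRYWISE: `e3OfK N K′ (G′ p) − e3OfK N K (G p)` = leaf-03 g15's `e3K3_sub_telescope` in the three legs
  (`(K′−K) K′ K′ + K (K′−K) K′ + K K (K′−K)`, on `G′ p`) + d1's `e3OfK_add_of_bdd` in the table (`K K K` on `(G′ − G) p`, a factor-form family on `F′ − F`) ⇒ §1 four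
  times ⇒ constant `(3·CD·CK²·CF + CK³·CFd)·|c₀|·Ψ(m)`; **`driftRows_of_rows`** — both rows of the two-summand table `cout • (e3OfK N K (G p) + e3OfK N K (G₂ p))`'s
  one-step difference (the `R ∕ R″` twins share `F`), constant `2·|cout|·|c₀|·(3·CD·CK²·CF + CK³·CFd)·Ψ(m)`, rate `m∕8`, `m = min δF δK ∕ 2`.
* §1 HERE (generic `d`, `1 ≤ Lc`) **`driftRows_level`** (one level, explicit constant `2·|cout|·|q_l|·(3·cK·θK^l·C²·Cs + C³·cS·θS^l)·Ψ`) and **`exists_evenRowsDrift_uniform_of_rows`**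
  — A SOCKET: §3 at `(K♮ᴱ_l, K♮ᴱ_{l+1}; S′_l, S′_{l+1})` with `CD := cK·θK^l` (`hGall l 1`), `CFd := cS·θS^l` (`hSall l 1`), the factor form by leaf-03's
  `evenLetterTable_eq_commFactor` at both levels — the level-`(l+1)` scalar moved to level `l` by the DISPLAYED row `hq : q_{l+1} = q_l` (at the comb pin `q_l` IS
  `l`-free — d1-leaf-07's `c_H`; a drifting lock scalar would need its own Cauchy row, not typed here) —, MY block-symbol lemmas; then `|q_l| ≤ c₀` (`hcH`) and
  `θK, θS ≤ max θK θS`: `∃ CEd θE δE, 0 ≤ θE < 1 ∧ 0 < δE ∧ ∀ l, hEd₁(l) ∧ hEd₂(l)` with rate `CEd·θE^l`, `θE = max θK θS`, `δE = min δs δ ∕ 16`, for ANY residual letters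
  `R l`, `R″ l` — leaf-01 g72's PART 6a ∕ 6b binders `hEd₁ ∕ hEd₂` at `ε = 1` with `S₀ := SpureRecAt … l`, `S₁ := SpureRecAt … (l+1)`, `cH₀ := cH l`, `cH₁ := cH (l+1)`,
  `R₀ := R l`, `R₁ := R (l+1)` (and the `R″` twins), outer scalar `cout` free (his is `cE₂·Lc^{2(d+1)}·(Lc^{d+1})⁻¹∕2`).
* §2 HERE (`d = 3`, `2 ≤ Lc`, pin `cE = Lc^{3+1}`) **`exists_evenRowsDrift_uniform_three`** — §1 with `hG ∕ hGall` := road P1's `KSlotAssembly.convCKWall_holds` (uniform decay AND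
  Cauchy rate of the unit step resolvents) ⨾ asym1's `HessKerCoDressedBmWall.exists_coDressedBm_unit_rows` (both rows survive the axial dressing), `hS ∕ hSall` := the OWNER
  gan24-p1 g22's `SrecAtSlotRowsFinal.exists_hS_hSall_SrecAt_three` ⨾ MY `WrecAtSlotRows.exists_spureRecAt_rows_three_of_srecAt_rows` («S′Shape» ∧ «S′Cauchy»): the drift
  rows for ALL levels MODULO `hcH`, `hq` ONLY.
READING: with `BlockCommutatorStepLetter` (row (ii)) and THIS file (row (ii′)) the S-step inputs of BOTH displayed rows `hcell` ((α-END-b)) and `hcelld` ((α-END-b′)) of the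
OWNER gan24-p1 g34's `T2DriftEvenEndRows` are discharged, on the SLOT side, down to road P1's K-slot (shape ∧ rate) and the OWNER's S-slot END, through leaf-01 g72's (b1)
PARTs 4 ∕ 6a ∕ 6b and leaf-03 g66's FILEs 1–5; the LEG half is (Q-L) (OPEN, display (H1)^{⊥}); (C) is an2's.  CONDITIONAL on the displayed rows; asserts NO bound on
Bałaban's tables beyond them; discharges NOTHING of `hcelld` ∕ `hcell` ∕ (Q-L) ∕ (C) ∕ «T2Shape^{ev}» ∕ «T2Drift^{ev}» ∕ (hW, hWall); NEVER «G-an2-4 closed» as (CONV-C); NOT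
D1, NOT `BetaPertH`, NOT continuum, NOT Clay; not in print — our bookkeeping.  2026-08-23.
-/

noncomputable section

open Finset
open scoped BigOperators
open Literature.MathematicalPhysics.QuantumFieldTheory
open Literature.MathematicalPhysics.QuantumFieldTheory.Balaban1983to89
open Literature.MathematicalPhysics.QuantumFieldTheory.Balaban1983to89.Beta
open B12Sec2to5 (l1 l1_nonneg)
open ExpKernelCalculus (MKer Site Decays BiLoc VertexFamily comp Zl Zl_nonneg l1_sub_triangle l1_sub_symm l1_natSmul biLoc_comp_decays)
open OneStepResolventKernel (Fib LocStencil wsum decays_mono biLoc_mono)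
open OneStepKernelFamily (KInvStep vertexOfK colH vertexFamily_vertexOfK)
open BalabanStepJetsSucc (mmRead biLoc_comp_right biLoc_mmRead)
open BalabanCompositeJets (LocStencil₂)
open AffineAveraging (box toSite)
open Summit.QuantumFields.BalabanUV.Beta.BorderedHessian (diagK)
open Summit.QuantumFields.BalabanUV.Beta.HessKerDressedUnits (unitK unitS)
open Summit.QuantumFields.BalabanUV.Beta.AxialDressingRooted (coDressKBmAt)
open Summit.QuantumFields.BalabanUV.Beta.SpineRooted (SpureRecAt e3OfK e3OfK_apply)
open Summit.QuantumFields.BalabanUV.Beta.WardLocusRecursive (SrecAt)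
open Summit.QuantumFields.BalabanUV.Beta.AveragingWardRootedStencils (legInd)
open Summit.QuantumFields.BalabanUV.Beta.HessKerCoDressedBmWall (exists_coDressedBm_unit_rows)
open Summit.QuantumFields.BalabanUV.Beta.GAN24.CombesThomas (sfStep smStep sfStep_ne_zero smStep_ne_zero)
open Summit.QuantumFields.BalabanUV.Beta.GAN24.KSlotAssembly (convCKWall_holds)
open Summit.QuantumFields.BalabanUV.Beta.GAN24.WSlotCauchyOfShapes (locStencil₂_le_mono)
open Summit.QuantumFields.BalabanUV.Beta.GAN24.WrecAtSlotRows (exists_spureRecAt_rows_three_of_srecAt_rows)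
open Summit.QuantumFields.BalabanUV.Beta.GAN24.SrecAtSlotRowsFinal (exists_hS_hSall_SrecAt_three)
open Summit.QuantumFields.BalabanUV.Beta.GAN24.BlockCommutatorStepLetter (abs_blockLegInd_le blockLegInd_support)
open Summit.QuantumFields.BalabanUV.Beta.GAN24.SlavedSummandLetterRows (evenLetterTable_eq_commFactor)
open Summit.QuantumFields.BalabanUV.Beta.GAN24.SlavedSummandLetterDriftRows (driftRows_of_rows)

namespace Summit.QuantumFields.BalabanUV.Beta.GAN24.BlockCommutatorStepLetterDrift

variable {d : ℕ}

/-! ## §1 The drift twin of `BlockCommutatorStepLetter`: the rows `hEd₁ ∕ hEd₂` of leaf-01 g72's PART 6a ∕ 6b, for every level, at `ε = 1` -/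

section Levels

variable {Lc : ℕ} [NeZero Lc] {r : Fin (d + 1) → ℕ}

/-- NOT IN PRINT; OUR BOOKKEEPING — A SOCKET, ONE LEVEL ([folklore] composition: PART 1's `driftRows_of_rows` at the pair of levels `(l, l + 1)` of the literal — `K := K♮ᴱ_l`,
`K′ := K♮ᴱ_{l+1}`, `F := S′_l`, `F′ := S′_{l+1}`, `CD := cK·θK^l`, `CFd := cS·θS^l`; the factor form by leaf-03 g66's `evenLetterTable_eq_commFactor` at both levels, the
scalar of level `l + 1` moved to level `l` by the DISPLAYED row `hq`; MY `abs_blockLegInd_le` ∕ `blockLegInd_support` for the block symbol; generic `d`, in-block root `r`,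
`1 ≤ Lc`).  **THE DRIFT ROWS `hEd₁ ∕ hEd₂` OF leaf-01 g72's `HalfMemberSlavedDivergenceDrift{,Snd}` AT `ε = 1`, LEVEL `l`, with the level-`l` constant
`2·|cout|·|q_l|·(3·cK·θK^l·C²·Cs + C³·cS·θS^l)·Ψ`** (`q_l = (sf_l·sm_l)⁻¹·(cH l)⁻¹`).  Every displayed row is a HYPOTHESIS; asserts NO bound beyond them. -/
theorem driftRows_level (hLc : 1 ≤ Lc) (hr : r ∈ box (d + 1) Lc) (cE cVH cΛ cout : ℝ) (cH : ℕ → ℝ)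
    (hq : ∀ l, (sfStep Lc (l + 1) * smStep d Lc (l + 1))⁻¹ * (cH (l + 1))⁻¹ = (sfStep Lc l * smStep d Lc l)⁻¹ * (cH l)⁻¹)
    {C cK θK δ : ℝ}
    (hG : ∀ j, Decays (unitK (sfStep Lc j) (smStep d Lc j) (coDressKBmAt (toSite r) Lc (KInvStep (d := d) Lc j))) C δ)
    (hGall : ∀ k j, Decays (unitK (sfStep Lc (k + j)) (smStep d Lc (k + j)) (coDressKBmAt (toSite r) Lc (KInvStep (d := d) Lc (k + j)))
        - unitK (sfStep Lc k) (smStep d Lc k) (coDressKBmAt (toSite r) Lc (KInvStep (d := d) Lc k))) (cK * θK ^ k) δ)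
    (hδ : 0 < δ)
    {Cs cS θS δs : ℝ} (hS : ∀ j, LocStencil (unitS (sfStep Lc j) (smStep d Lc j) (SpureRecAt d Lc (toSite r) cE cVH cΛ j)) Cs δs)
    (hSall : ∀ k j, LocStencil (unitS (sfStep Lc (k + j)) (smStep d Lc (k + j)) (SpureRecAt d Lc (toSite r) cE cVH cΛ (k + j))
        - unitS (sfStep Lc k) (smStep d Lc k) (SpureRecAt d Lc (toSite r) cE cVH cΛ k)) (cS * θS ^ k) δs)
    (hδs : 0 < δs)
    (R R'' : ℕ → (Fin (d + 1) → ℤ) → Fin (d + 1) → (Fin (d + 1) → ℤ) → MKer (d + 1) (Fib d)) (l : ℕ) :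
      LocStencil₂ (fun (_ : Fin (d + 1)) (p : Fin (d + 1) → ℤ) (κ' : Fin (d + 1)) (u' : Fin (d + 1) → ℤ) =>
            cout • (e3OfK Lc (unitK (sfStep Lc (l + 1)) (smStep d Lc (l + 1)) (coDressKBmAt (toSite r) Lc (KInvStep (d := d) Lc (l + 1))))
                (fun κ' u' => (sfStep Lc (l + 1) * smStep d Lc (l + 1))⁻¹ • unitS (sfStep Lc (l + 1)) (smStep d Lc (l + 1))
                  (fun κ' u' => (cH (l + 1))⁻¹ • ((((1 : ℝ) + 1) / 2) • (comp (SpureRecAt d Lc (toSite r) cE cVH cΛ (l + 1) κ' u')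
                      (diagK (((1 : ℝ) / 2) • ∑ v ∈ box (d + 1) Lc, legInd (toSite r) ((Lc : ℤ) • p + toSite v)))
                    - comp (diagK (((1 : ℝ) / 2) • ∑ v ∈ box (d + 1) Lc, legInd (toSite r) ((Lc : ℤ) • p + toSite v)))
                      (SpureRecAt d Lc (toSite r) cE cVH cΛ (l + 1) κ' u')) + (((1 : ℝ) - 1) / 2) • R (l + 1) p κ' u')) κ' u') κ' u'
              + e3OfK Lc (unitK (sfStep Lc (l + 1)) (smStep d Lc (l + 1)) (coDressKBmAt (toSite r) Lc (KInvStep (d := d) Lc (l + 1))))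
                (fun κ u => (sfStep Lc (l + 1) * smStep d Lc (l + 1))⁻¹ • unitS (sfStep Lc (l + 1)) (smStep d Lc (l + 1))
                  (fun κ u => (cH (l + 1))⁻¹ • ((((1 : ℝ) + 1) / 2) • (comp (SpureRecAt d Lc (toSite r) cE cVH cΛ (l + 1) κ u)
                      (diagK (((1 : ℝ) / 2) • ∑ v ∈ box (d + 1) Lc, legInd (toSite r) ((Lc : ℤ) • p + toSite v)))
                    - comp (diagK (((1 : ℝ) / 2) • ∑ v ∈ box (d + 1) Lc, legInd (toSite r) ((Lc : ℤ) • p + toSite v)))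
                      (SpureRecAt d Lc (toSite r) cE cVH cΛ (l + 1) κ u)) + (((1 : ℝ) - 1) / 2) • R'' (l + 1) p κ u)) κ u) κ' u')
        - (cout • (e3OfK Lc (unitK (sfStep Lc l) (smStep d Lc l) (coDressKBmAt (toSite r) Lc (KInvStep (d := d) Lc l)))
              (fun κ' u' => (sfStep Lc l * smStep d Lc l)⁻¹ • unitS (sfStep Lc l) (smStep d Lc l)
                (fun κ' u' => (cH l)⁻¹ • ((((1 : ℝ) + 1) / 2) • (comp (SpureRecAt d Lc (toSite r) cE cVH cΛ l κ' u')
                    (diagK (((1 : ℝ) / 2) • ∑ v ∈ box (d + 1) Lc, legInd (toSite r) ((Lc : ℤ) • p + toSite v)))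
                  - comp (diagK (((1 : ℝ) / 2) • ∑ v ∈ box (d + 1) Lc, legInd (toSite r) ((Lc : ℤ) • p + toSite v)))
                    (SpureRecAt d Lc (toSite r) cE cVH cΛ l κ' u')) + (((1 : ℝ) - 1) / 2) • R l p κ' u')) κ' u') κ' u'
            + e3OfK Lc (unitK (sfStep Lc l) (smStep d Lc l) (coDressKBmAt (toSite r) Lc (KInvStep (d := d) Lc l)))
              (fun κ u => (sfStep Lc l * smStep d Lc l)⁻¹ • unitS (sfStep Lc l) (smStep d Lc l)
                (fun κ u => (cH l)⁻¹ • ((((1 : ℝ) + 1) / 2) • (comp (SpureRecAt d Lc (toSite r) cE cVH cΛ l κ u)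
                    (diagK (((1 : ℝ) / 2) • ∑ v ∈ box (d + 1) Lc, legInd (toSite r) ((Lc : ℤ) • p + toSite v)))
                  - comp (diagK (((1 : ℝ) / 2) • ∑ v ∈ box (d + 1) Lc, legInd (toSite r) ((Lc : ℤ) • p + toSite v)))
                    (SpureRecAt d Lc (toSite r) cE cVH cΛ l κ u)) + (((1 : ℝ) - 1) / 2) • R'' l p κ u)) κ u) κ' u')))
      (2 * |cout| * |(sfStep Lc l * smStep d Lc l)⁻¹ * (cH l)⁻¹| * (3 * (cK * θK ^ l) * C * C * Cs + C * C * C * (cS * θS ^ l))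
      * ((Fintype.card (Fib d) : ℝ) * (Fintype.card (Fib d) : ℝ)
      * (2 * ((1 : ℝ) / 2 * (box (d + 1) Lc).card) * (((d + 1 : ℕ) : ℝ) * Zl (d + 1) (min δs δ / 2)) * Real.exp (min δs δ / 2 / 2 * (2 * (((d + 1 : ℕ) : ℝ) * Lc))))
      * Zl (d + 1) (min δs δ / 2 / 2 - min δs δ / 2 / 4) * Zl (d + 1) (min δs δ / 2 / 4 - min δs δ / 2 / 8))) (min δs δ / 2 / 8) ∧
      LocStencil₂ (fun (κ : Fin (d + 1)) (u : Fin (d + 1) → ℤ) (_ : Fin (d + 1)) (p : Fin (d + 1) → ℤ) =>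
            cout • (e3OfK Lc (unitK (sfStep Lc (l + 1)) (smStep d Lc (l + 1)) (coDressKBmAt (toSite r) Lc (KInvStep (d := d) Lc (l + 1))))
                (fun κ' u' => (sfStep Lc (l + 1) * smStep d Lc (l + 1))⁻¹ • unitS (sfStep Lc (l + 1)) (smStep d Lc (l + 1))
                  (fun κ' u' => (cH (l + 1))⁻¹ • ((((1 : ℝ) + 1) / 2) • (comp (SpureRecAt d Lc (toSite r) cE cVH cΛ (l + 1) κ' u')
                      (diagK (((1 : ℝ) / 2) • ∑ v ∈ box (d + 1) Lc, legInd (toSite r) ((Lc : ℤ) • p + toSite v)))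
                    - comp (diagK (((1 : ℝ) / 2) • ∑ v ∈ box (d + 1) Lc, legInd (toSite r) ((Lc : ℤ) • p + toSite v)))
                      (SpureRecAt d Lc (toSite r) cE cVH cΛ (l + 1) κ' u')) + (((1 : ℝ) - 1) / 2) • R (l + 1) p κ' u')) κ' u') κ u
              + e3OfK Lc (unitK (sfStep Lc (l + 1)) (smStep d Lc (l + 1)) (coDressKBmAt (toSite r) Lc (KInvStep (d := d) Lc (l + 1))))
                (fun κ u => (sfStep Lc (l + 1) * smStep d Lc (l + 1))⁻¹ • unitS (sfStep Lc (l + 1)) (smStep d Lc (l + 1))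
                  (fun κ u => (cH (l + 1))⁻¹ • ((((1 : ℝ) + 1) / 2) • (comp (SpureRecAt d Lc (toSite r) cE cVH cΛ (l + 1) κ u)
                      (diagK (((1 : ℝ) / 2) • ∑ v ∈ box (d + 1) Lc, legInd (toSite r) ((Lc : ℤ) • p + toSite v)))
                    - comp (diagK (((1 : ℝ) / 2) • ∑ v ∈ box (d + 1) Lc, legInd (toSite r) ((Lc : ℤ) • p + toSite v)))
                      (SpureRecAt d Lc (toSite r) cE cVH cΛ (l + 1) κ u)) + (((1 : ℝ) - 1) / 2) • R'' (l + 1) p κ u)) κ u) κ u)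
        - (cout • (e3OfK Lc (unitK (sfStep Lc l) (smStep d Lc l) (coDressKBmAt (toSite r) Lc (KInvStep (d := d) Lc l)))
              (fun κ' u' => (sfStep Lc l * smStep d Lc l)⁻¹ • unitS (sfStep Lc l) (smStep d Lc l)
                (fun κ' u' => (cH l)⁻¹ • ((((1 : ℝ) + 1) / 2) • (comp (SpureRecAt d Lc (toSite r) cE cVH cΛ l κ' u')
                    (diagK (((1 : ℝ) / 2) • ∑ v ∈ box (d + 1) Lc, legInd (toSite r) ((Lc : ℤ) • p + toSite v)))
                  - comp (diagK (((1 : ℝ) / 2) • ∑ v ∈ box (d + 1) Lc, legInd (toSite r) ((Lc : ℤ) • p + toSite v)))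
                    (SpureRecAt d Lc (toSite r) cE cVH cΛ l κ' u')) + (((1 : ℝ) - 1) / 2) • R l p κ' u')) κ' u') κ u
            + e3OfK Lc (unitK (sfStep Lc l) (smStep d Lc l) (coDressKBmAt (toSite r) Lc (KInvStep (d := d) Lc l)))
              (fun κ u => (sfStep Lc l * smStep d Lc l)⁻¹ • unitS (sfStep Lc l) (smStep d Lc l)
                (fun κ u => (cH l)⁻¹ • ((((1 : ℝ) + 1) / 2) • (comp (SpureRecAt d Lc (toSite r) cE cVH cΛ l κ u)
                    (diagK (((1 : ℝ) / 2) • ∑ v ∈ box (d + 1) Lc, legInd (toSite r) ((Lc : ℤ) • p + toSite v)))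
                  - comp (diagK (((1 : ℝ) / 2) • ∑ v ∈ box (d + 1) Lc, legInd (toSite r) ((Lc : ℤ) • p + toSite v)))
                    (SpureRecAt d Lc (toSite r) cE cVH cΛ l κ u)) + (((1 : ℝ) - 1) / 2) • R'' l p κ u)) κ u) κ u)))
      (2 * |cout| * |(sfStep Lc l * smStep d Lc l)⁻¹ * (cH l)⁻¹| * (3 * (cK * θK ^ l) * C * C * Cs + C * C * C * (cS * θS ^ l))
      * ((Fintype.card (Fib d) : ℝ) * (Fintype.card (Fib d) : ℝ)
      * (2 * ((1 : ℝ) / 2 * (box (d + 1) Lc).card) * (((d + 1 : ℕ) : ℝ) * Zl (d + 1) (min δs δ / 2)) * Real.exp (min δs δ / 2 / 2 * (2 * (((d + 1 : ℕ) : ℝ) * Lc))))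
      * Zl (d + 1) (min δs δ / 2 / 2 - min δs δ / 2 / 4) * Zl (d + 1) (min δs δ / 2 / 4 - min δs δ / 2 / 8))) (min δs δ / 2 / 8) := by
  exact driftRows_of_rows (N := Lc) (CK := C) (CD := cK * θK ^ l) (δK := δ) (CF := Cs) (CFd := cS * θS ^ l) (δF := δs)
    (cg := (1 : ℝ) / 2 * (box (d + 1) Lc).card) (W := 2 * (((d + 1 : ℕ) : ℝ) * Lc))
    (K := unitK (sfStep Lc l) (smStep d Lc l) (coDressKBmAt (toSite r) Lc (KInvStep (d := d) Lc l)))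
    (K' := unitK (sfStep Lc (l + 1)) (smStep d Lc (l + 1)) (coDressKBmAt (toSite r) Lc (KInvStep (d := d) Lc (l + 1))))
    (F := unitS (sfStep Lc l) (smStep d Lc l) (SpureRecAt d Lc (toSite r) cE cVH cΛ l))
    (F' := unitS (sfStep Lc (l + 1)) (smStep d Lc (l + 1)) (SpureRecAt d Lc (toSite r) cE cVH cΛ (l + 1)))
    (G := fun p => (fun κ' u' => (sfStep Lc l * smStep d Lc l)⁻¹ • unitS (sfStep Lc l) (smStep d Lc l) (fun κ' u' => (cH l)⁻¹ • ((((1 : ℝ) + 1) / 2) • (comp (SpureRecAt d Lc (toSite r) cE cVH cΛ l κ' u') (diagK (((1 : ℝ) / 2) • ∑ v ∈ box (d + 1) Lc, legInd (toSite r) ((Lc : ℤ) • p + toSite v))) - comp (diagK (((1 : ℝ) / 2) • ∑ v ∈ box (d + 1) Lc, legInd (toSite r) ((Lc : ℤ) • p + toSite v))) (SpureRecAt d Lc (toSite r) cE cVH cΛ l κ' u')) + (((1 : ℝ) - 1) / 2) • R l p κ' u')) κ' u'))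
    (G' := fun p => (fun κ' u' => (sfStep Lc (l + 1) * smStep d Lc (l + 1))⁻¹ • unitS (sfStep Lc (l + 1)) (smStep d Lc (l + 1)) (fun κ' u' => (cH (l + 1))⁻¹ • ((((1 : ℝ) + 1) / 2) • (comp (SpureRecAt d Lc (toSite r) cE cVH cΛ (l + 1) κ' u') (diagK (((1 : ℝ) / 2) • ∑ v ∈ box (d + 1) Lc, legInd (toSite r) ((Lc : ℤ) • p + toSite v))) - comp (diagK (((1 : ℝ) / 2) • ∑ v ∈ box (d + 1) Lc, legInd (toSite r) ((Lc : ℤ) • p + toSite v))) (SpureRecAt d Lc (toSite r) cE cVH cΛ (l + 1) κ' u')) + (((1 : ℝ) - 1) / 2) • R (l + 1) p κ' u')) κ' u'))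
    (G₂ := fun p => (fun κ u => (sfStep Lc l * smStep d Lc l)⁻¹ • unitS (sfStep Lc l) (smStep d Lc l) (fun κ u => (cH l)⁻¹ • ((((1 : ℝ) + 1) / 2) • (comp (SpureRecAt d Lc (toSite r) cE cVH cΛ l κ u) (diagK (((1 : ℝ) / 2) • ∑ v ∈ box (d + 1) Lc, legInd (toSite r) ((Lc : ℤ) • p + toSite v))) - comp (diagK (((1 : ℝ) / 2) • ∑ v ∈ box (d + 1) Lc, legInd (toSite r) ((Lc : ℤ) • p + toSite v))) (SpureRecAt d Lc (toSite r) cE cVH cΛ l κ u)) + (((1 : ℝ) - 1) / 2) • R'' l p κ u)) κ u))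
    (G₂' := fun p => (fun κ u => (sfStep Lc (l + 1) * smStep d Lc (l + 1))⁻¹ • unitS (sfStep Lc (l + 1)) (smStep d Lc (l + 1)) (fun κ u => (cH (l + 1))⁻¹ • ((((1 : ℝ) + 1) / 2) • (comp (SpureRecAt d Lc (toSite r) cE cVH cΛ (l + 1) κ u) (diagK (((1 : ℝ) / 2) • ∑ v ∈ box (d + 1) Lc, legInd (toSite r) ((Lc : ℤ) • p + toSite v))) - comp (diagK (((1 : ℝ) / 2) • ∑ v ∈ box (d + 1) Lc, legInd (toSite r) ((Lc : ℤ) • p + toSite v))) (SpureRecAt d Lc (toSite r) cE cVH cΛ (l + 1) κ u)) + (((1 : ℝ) - 1) / 2) • R'' (l + 1) p κ u)) κ u))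
    (c₀ := (sfStep Lc l * smStep d Lc l)⁻¹ * (cH l)⁻¹)
    (g := fun p => ((1 : ℝ) / 2) • ∑ v ∈ box (d + 1) Lc, legInd (toSite r) ((Lc : ℤ) • p + toSite v))
    hLc (hG l) (hG (l + 1)) (hGall l 1) hδ (hS l) (hS (l + 1)) (hSall l 1) hδs
    (fun p κ u x z a b => evenLetterTable_eq_commFactor (S := SpureRecAt d Lc (toSite r) cE cVH cΛ l) (X := fun p => diagK (((1 : ℝ) / 2) • ∑ v ∈ box (d + 1) Lc, legInd (toSite r) ((Lc : ℤ) • p + toSite v)))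
      (g := fun p => ((1 : ℝ) / 2) • ∑ v ∈ box (d + 1) Lc, legInd (toSite r) ((Lc : ℤ) • p + toSite v)) (fun p => rfl) (sfStep Lc l) (smStep d Lc l) (cH l) (R l) p κ u x z a b)
    (fun p κ u x z a b => by
      rw [evenLetterTable_eq_commFactor (S := SpureRecAt d Lc (toSite r) cE cVH cΛ (l + 1)) (X := fun p => diagK (((1 : ℝ) / 2) • ∑ v ∈ box (d + 1) Lc, legInd (toSite r) ((Lc : ℤ) • p + toSite v)))
        (g := fun p => ((1 : ℝ) / 2) • ∑ v ∈ box (d + 1) Lc, legInd (toSite r) ((Lc : ℤ) • p + toSite v)) (fun p => rfl) (sfStep Lc (l + 1)) (smStep d Lc (l + 1)) (cH (l + 1)) (R (l + 1)) p κ u x z a b, hq l])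
    (fun p κ u x z a b => evenLetterTable_eq_commFactor (S := SpureRecAt d Lc (toSite r) cE cVH cΛ l) (X := fun p => diagK (((1 : ℝ) / 2) • ∑ v ∈ box (d + 1) Lc, legInd (toSite r) ((Lc : ℤ) • p + toSite v)))
      (g := fun p => ((1 : ℝ) / 2) • ∑ v ∈ box (d + 1) Lc, legInd (toSite r) ((Lc : ℤ) • p + toSite v)) (fun p => rfl) (sfStep Lc l) (smStep d Lc l) (cH l) (R'' l) p κ u x z a b)
    (fun p κ u x z a b => by
      rw [evenLetterTable_eq_commFactor (S := SpureRecAt d Lc (toSite r) cE cVH cΛ (l + 1)) (X := fun p => diagK (((1 : ℝ) / 2) • ∑ v ∈ box (d + 1) Lc, legInd (toSite r) ((Lc : ℤ) • p + toSite v)))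
        (g := fun p => ((1 : ℝ) / 2) • ∑ v ∈ box (d + 1) Lc, legInd (toSite r) ((Lc : ℤ) • p + toSite v)) (fun p => rfl) (sfStep Lc (l + 1)) (smStep d Lc (l + 1)) (cH (l + 1)) (R'' (l + 1)) p κ u x z a b, hq l])
    (fun p z b => abs_blockLegInd_le (toSite r) p z b) (fun p z b hh => blockLegInd_support hr p z b hh) cout


/-- NOT IN PRINT; OUR BOOKKEEPING — A SOCKET ([folklore] composition: §1's socket `driftRows_level` (PART 1's `driftRows_of_rows`) level by level at the literal — `K := K♮ᴱ_l`, `K′ := K♮ᴱ_{l+1}`, `F := S′_l`,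
`F′ := S′_{l+1}`, the factor form by leaf-03 g66's `evenLetterTable_eq_commFactor` at both levels (the scalar of level `l + 1` moved to level `l` by the DISPLAYED
row `hq`), MY `abs_blockLegInd_le` ∕ `blockLegInd_support` for the block symbol; then `|q_l| ≤ c₀` (`hcH`) and the two geometric rates merged at `max θK θS`; generic `d`,
in-block root `r`, `1 ≤ Lc`).  **THE DRIFT ROWS `hEd₁ ∕ hEd₂` OF leaf-01 g72's `HalfMemberSlavedDivergenceDrift{,Snd}` AT `ε = 1`, FOR ALL LEVELS WITH ONE
`(CEd, θE, δE)`**: from the dressed-K uniform AND Cauchy rows `hG ∕ hGall`, «S′Shape» AND «S′Cauchy» `hS ∕ hSall`, and the two scalar rows `hcH : |(sf_l·sm_l)⁻¹·(cH l)⁻¹| ≤ c₀`,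
`hq : (sf_{l+1}·sm_{l+1})⁻¹·(cH (l+1))⁻¹ = (sf_l·sm_l)⁻¹·(cH l)⁻¹` (at the comb pin that product is `l`-free — d1-leaf-07's `c_H`), for ANY residual letters `R l`, `R″ l`
(they carry `(1 − 1)∕2 = 0`): `∃ CEd θE δE, 0 ≤ θE < 1 ∧ 0 < δE ∧ ∀ l, hEd₁(l) ∧ hEd₂(l)` with rate `CEd·θE^l`.  Every displayed row is a HYPOTHESIS here (TREE at `d = 3`:
§2); asserts NO bound beyond them; NOTHING of `hcelld` ∕ `hcell` ∕ (Q-L) ∕ (C) ∕ «T2Drift^{ev}» discharged. -/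
theorem exists_evenRowsDrift_uniform_of_rows (hLc : 1 ≤ Lc) (hr : r ∈ box (d + 1) Lc) (cE cVH cΛ cout : ℝ) (cH : ℕ → ℝ) {c₀ : ℝ}
    (hcH : ∀ l, |(sfStep Lc l * smStep d Lc l)⁻¹ * (cH l)⁻¹| ≤ c₀)
    (hq : ∀ l, (sfStep Lc (l + 1) * smStep d Lc (l + 1))⁻¹ * (cH (l + 1))⁻¹ = (sfStep Lc l * smStep d Lc l)⁻¹ * (cH l)⁻¹)
    {C cK θK δ : ℝ}
    (hG : ∀ j, Decays (unitK (sfStep Lc j) (smStep d Lc j) (coDressKBmAt (toSite r) Lc (KInvStep (d := d) Lc j))) C δ)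
    (hGall : ∀ k j, Decays (unitK (sfStep Lc (k + j)) (smStep d Lc (k + j)) (coDressKBmAt (toSite r) Lc (KInvStep (d := d) Lc (k + j)))
        - unitK (sfStep Lc k) (smStep d Lc k) (coDressKBmAt (toSite r) Lc (KInvStep (d := d) Lc k))) (cK * θK ^ k) δ)
    (hδ : 0 < δ) (hθK0 : 0 ≤ θK) (hθK1 : θK < 1)
    {Cs cS θS δs : ℝ} (hS : ∀ j, LocStencil (unitS (sfStep Lc j) (smStep d Lc j) (SpureRecAt d Lc (toSite r) cE cVH cΛ j)) Cs δs)
    (hSall : ∀ k j, LocStencil (unitS (sfStep Lc (k + j)) (smStep d Lc (k + j)) (SpureRecAt d Lc (toSite r) cE cVH cΛ (k + j))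
        - unitS (sfStep Lc k) (smStep d Lc k) (SpureRecAt d Lc (toSite r) cE cVH cΛ k)) (cS * θS ^ k) δs)
    (hδs : 0 < δs) (hθS0 : 0 ≤ θS) (hθS1 : θS < 1)
    (R R'' : ℕ → (Fin (d + 1) → ℤ) → Fin (d + 1) → (Fin (d + 1) → ℤ) → MKer (d + 1) (Fib d)) :
    ∃ CEd θE δE : ℝ, 0 ≤ θE ∧ θE < 1 ∧ 0 < δE ∧ ∀ l,
      LocStencil₂ (fun (_ : Fin (d + 1)) (p : Fin (d + 1) → ℤ) (κ' : Fin (d + 1)) (u' : Fin (d + 1) → ℤ) =>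
            cout • (e3OfK Lc (unitK (sfStep Lc (l + 1)) (smStep d Lc (l + 1)) (coDressKBmAt (toSite r) Lc (KInvStep (d := d) Lc (l + 1))))
                (fun κ' u' => (sfStep Lc (l + 1) * smStep d Lc (l + 1))⁻¹ • unitS (sfStep Lc (l + 1)) (smStep d Lc (l + 1))
                  (fun κ' u' => (cH (l + 1))⁻¹ • ((((1 : ℝ) + 1) / 2) • (comp (SpureRecAt d Lc (toSite r) cE cVH cΛ (l + 1) κ' u')
                      (diagK (((1 : ℝ) / 2) • ∑ v ∈ box (d + 1) Lc, legInd (toSite r) ((Lc : ℤ) • p + toSite v)))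
                    - comp (diagK (((1 : ℝ) / 2) • ∑ v ∈ box (d + 1) Lc, legInd (toSite r) ((Lc : ℤ) • p + toSite v)))
                      (SpureRecAt d Lc (toSite r) cE cVH cΛ (l + 1) κ' u')) + (((1 : ℝ) - 1) / 2) • R (l + 1) p κ' u')) κ' u') κ' u'
              + e3OfK Lc (unitK (sfStep Lc (l + 1)) (smStep d Lc (l + 1)) (coDressKBmAt (toSite r) Lc (KInvStep (d := d) Lc (l + 1))))
                (fun κ u => (sfStep Lc (l + 1) * smStep d Lc (l + 1))⁻¹ • unitS (sfStep Lc (l + 1)) (smStep d Lc (l + 1))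
                  (fun κ u => (cH (l + 1))⁻¹ • ((((1 : ℝ) + 1) / 2) • (comp (SpureRecAt d Lc (toSite r) cE cVH cΛ (l + 1) κ u)
                      (diagK (((1 : ℝ) / 2) • ∑ v ∈ box (d + 1) Lc, legInd (toSite r) ((Lc : ℤ) • p + toSite v)))
                    - comp (diagK (((1 : ℝ) / 2) • ∑ v ∈ box (d + 1) Lc, legInd (toSite r) ((Lc : ℤ) • p + toSite v)))
                      (SpureRecAt d Lc (toSite r) cE cVH cΛ (l + 1) κ u)) + (((1 : ℝ) - 1) / 2) • R'' (l + 1) p κ u)) κ u) κ' u')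
        - (cout • (e3OfK Lc (unitK (sfStep Lc l) (smStep d Lc l) (coDressKBmAt (toSite r) Lc (KInvStep (d := d) Lc l)))
              (fun κ' u' => (sfStep Lc l * smStep d Lc l)⁻¹ • unitS (sfStep Lc l) (smStep d Lc l)
                (fun κ' u' => (cH l)⁻¹ • ((((1 : ℝ) + 1) / 2) • (comp (SpureRecAt d Lc (toSite r) cE cVH cΛ l κ' u')
                    (diagK (((1 : ℝ) / 2) • ∑ v ∈ box (d + 1) Lc, legInd (toSite r) ((Lc : ℤ) • p + toSite v)))
                  - comp (diagK (((1 : ℝ) / 2) • ∑ v ∈ box (d + 1) Lc, legInd (toSite r) ((Lc : ℤ) • p + toSite v)))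
                    (SpureRecAt d Lc (toSite r) cE cVH cΛ l κ' u')) + (((1 : ℝ) - 1) / 2) • R l p κ' u')) κ' u') κ' u'
            + e3OfK Lc (unitK (sfStep Lc l) (smStep d Lc l) (coDressKBmAt (toSite r) Lc (KInvStep (d := d) Lc l)))
              (fun κ u => (sfStep Lc l * smStep d Lc l)⁻¹ • unitS (sfStep Lc l) (smStep d Lc l)
                (fun κ u => (cH l)⁻¹ • ((((1 : ℝ) + 1) / 2) • (comp (SpureRecAt d Lc (toSite r) cE cVH cΛ l κ u)
                    (diagK (((1 : ℝ) / 2) • ∑ v ∈ box (d + 1) Lc, legInd (toSite r) ((Lc : ℤ) • p + toSite v)))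
                  - comp (diagK (((1 : ℝ) / 2) • ∑ v ∈ box (d + 1) Lc, legInd (toSite r) ((Lc : ℤ) • p + toSite v)))
                    (SpureRecAt d Lc (toSite r) cE cVH cΛ l κ u)) + (((1 : ℝ) - 1) / 2) • R'' l p κ u)) κ u) κ' u'))) (CEd * θE ^ l) δE ∧
      LocStencil₂ (fun (κ : Fin (d + 1)) (u : Fin (d + 1) → ℤ) (_ : Fin (d + 1)) (p : Fin (d + 1) → ℤ) =>
            cout • (e3OfK Lc (unitK (sfStep Lc (l + 1)) (smStep d Lc (l + 1)) (coDressKBmAt (toSite r) Lc (KInvStep (d := d) Lc (l + 1))))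
                (fun κ' u' => (sfStep Lc (l + 1) * smStep d Lc (l + 1))⁻¹ • unitS (sfStep Lc (l + 1)) (smStep d Lc (l + 1))
                  (fun κ' u' => (cH (l + 1))⁻¹ • ((((1 : ℝ) + 1) / 2) • (comp (SpureRecAt d Lc (toSite r) cE cVH cΛ (l + 1) κ' u')
                      (diagK (((1 : ℝ) / 2) • ∑ v ∈ box (d + 1) Lc, legInd (toSite r) ((Lc : ℤ) • p + toSite v)))
                    - comp (diagK (((1 : ℝ) / 2) • ∑ v ∈ box (d + 1) Lc, legInd (toSite r) ((Lc : ℤ) • p + toSite v)))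
                      (SpureRecAt d Lc (toSite r) cE cVH cΛ (l + 1) κ' u')) + (((1 : ℝ) - 1) / 2) • R (l + 1) p κ' u')) κ' u') κ u
              + e3OfK Lc (unitK (sfStep Lc (l + 1)) (smStep d Lc (l + 1)) (coDressKBmAt (toSite r) Lc (KInvStep (d := d) Lc (l + 1))))
                (fun κ u => (sfStep Lc (l + 1) * smStep d Lc (l + 1))⁻¹ • unitS (sfStep Lc (l + 1)) (smStep d Lc (l + 1))
                  (fun κ u => (cH (l + 1))⁻¹ • ((((1 : ℝ) + 1) / 2) • (comp (SpureRecAt d Lc (toSite r) cE cVH cΛ (l + 1) κ u)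
                      (diagK (((1 : ℝ) / 2) • ∑ v ∈ box (d + 1) Lc, legInd (toSite r) ((Lc : ℤ) • p + toSite v)))
                    - comp (diagK (((1 : ℝ) / 2) • ∑ v ∈ box (d + 1) Lc, legInd (toSite r) ((Lc : ℤ) • p + toSite v)))
                      (SpureRecAt d Lc (toSite r) cE cVH cΛ (l + 1) κ u)) + (((1 : ℝ) - 1) / 2) • R'' (l + 1) p κ u)) κ u) κ u)
        - (cout • (e3OfK Lc (unitK (sfStep Lc l) (smStep d Lc l) (coDressKBmAt (toSite r) Lc (KInvStep (d := d) Lc l)))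
              (fun κ' u' => (sfStep Lc l * smStep d Lc l)⁻¹ • unitS (sfStep Lc l) (smStep d Lc l)
                (fun κ' u' => (cH l)⁻¹ • ((((1 : ℝ) + 1) / 2) • (comp (SpureRecAt d Lc (toSite r) cE cVH cΛ l κ' u')
                    (diagK (((1 : ℝ) / 2) • ∑ v ∈ box (d + 1) Lc, legInd (toSite r) ((Lc : ℤ) • p + toSite v)))
                  - comp (diagK (((1 : ℝ) / 2) • ∑ v ∈ box (d + 1) Lc, legInd (toSite r) ((Lc : ℤ) • p + toSite v)))
                    (SpureRecAt d Lc (toSite r) cE cVH cΛ l κ' u')) + (((1 : ℝ) - 1) / 2) • R l p κ' u')) κ' u') κ u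
            + e3OfK Lc (unitK (sfStep Lc l) (smStep d Lc l) (coDressKBmAt (toSite r) Lc (KInvStep (d := d) Lc l)))
              (fun κ u => (sfStep Lc l * smStep d Lc l)⁻¹ • unitS (sfStep Lc l) (smStep d Lc l)
                (fun κ u => (cH l)⁻¹ • ((((1 : ℝ) + 1) / 2) • (comp (SpureRecAt d Lc (toSite r) cE cVH cΛ l κ u)
                    (diagK (((1 : ℝ) / 2) • ∑ v ∈ box (d + 1) Lc, legInd (toSite r) ((Lc : ℤ) • p + toSite v)))
                  - comp (diagK (((1 : ℝ) / 2) • ∑ v ∈ box (d + 1) Lc, legInd (toSite r) ((Lc : ℤ) • p + toSite v)))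
                    (SpureRecAt d Lc (toSite r) cE cVH cΛ l κ u)) + (((1 : ℝ) - 1) / 2) • R'' l p κ u)) κ u) κ u))) (CEd * θE ^ l) δE   := by
  have hC : 0 ≤ C := (hG 0).nonneg (Sum.inl 0)
  have hcK : 0 ≤ cK := by simpa using (hGall 0 0).nonneg (Sum.inl 0)
  have hCs : 0 ≤ Cs := ((hS 0) 0 0).nonneg (Sum.inl 0)
  have hcS : 0 ≤ cS := by simpa using ((hSall 0 0) 0 0).nonneg (Sum.inl 0)
  have hc₀ : 0 ≤ c₀ := (abs_nonneg _).trans (hcH 0)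
  have hm : 0 < min δs δ / 2 := half_pos (lt_min hδs hδ)
  have hZ0 : 0 ≤ Zl (d + 1) (min δs δ / 2) := Zl_nonneg hm
  have hZ1 : 0 ≤ Zl (d + 1) (min δs δ / 2 / 2 - min δs δ / 2 / 4) := Zl_nonneg (by linarith)
  have hZ2 : 0 ≤ Zl (d + 1) (min δs δ / 2 / 4 - min δs δ / 2 / 8) := Zl_nonneg (by linarith)
  have hΨ0 : 0 ≤ ((Fintype.card (Fib d) : ℝ) * (Fintype.card (Fib d) : ℝ)
      * (2 * ((1 : ℝ) / 2 * (box (d + 1) Lc).card) * (((d + 1 : ℕ) : ℝ) * Zl (d + 1) (min δs δ / 2)) * Real.exp (min δs δ / 2 / 2 * (2 * (((d + 1 : ℕ) : ℝ) * Lc))))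
      * Zl (d + 1) (min δs δ / 2 / 2 - min δs δ / 2 / 4) * Zl (d + 1) (min δs δ / 2 / 4 - min δs δ / 2 / 8)) := by positivity
  refine ⟨2 * |cout| * c₀ * (3 * cK * C * C * Cs + C * C * C * cS) * ((Fintype.card (Fib d) : ℝ) * (Fintype.card (Fib d) : ℝ)
      * (2 * ((1 : ℝ) / 2 * (box (d + 1) Lc).card) * (((d + 1 : ℕ) : ℝ) * Zl (d + 1) (min δs δ / 2)) * Real.exp (min δs δ / 2 / 2 * (2 * (((d + 1 : ℕ) : ℝ) * Lc))))
      * Zl (d + 1) (min δs δ / 2 / 2 - min δs δ / 2 / 4) * Zl (d + 1) (min δs δ / 2 / 4 - min δs δ / 2 / 8)),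
    max θK θS, min δs δ / 2 / 8, hθK0.trans (le_max_left _ _), max_lt hθK1 hθS1, by positivity, fun l => ?_⟩
  -- the level-`l` constant is monotone in `|q_l| ≤ c₀` and in the two rates `θK, θS ≤ max θK θS`
  have hq' := hcH l
  have hθl : 0 ≤ max θK θS := hθK0.trans (le_max_left _ _)
  have t1 : θK ^ l ≤ (max θK θS) ^ l := pow_le_pow_left₀ hθK0 (le_max_left _ _) l
  have t2 : θS ^ l ≤ (max θK θS) ^ l := pow_le_pow_left₀ hθS0 (le_max_right _ _) l
  have u1 : cK * θK ^ l ≤ cK * (max θK θS) ^ l := mul_le_mul_of_nonneg_left t1 hcK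
  have u2 : cS * θS ^ l ≤ cS * (max θK θS) ^ l := mul_le_mul_of_nonneg_left t2 hcS
  have hCCC : 0 ≤ C * C * C := mul_nonneg (mul_nonneg hC hC) hC
  have hA : 3 * (cK * θK ^ l) * C * C * Cs + C * C * C * (cS * θS ^ l)
      ≤ 3 * (cK * (max θK θS) ^ l) * C * C * Cs + C * C * C * (cS * (max θK θS) ^ l) :=
    add_le_add (mul_le_mul_of_nonneg_right (mul_le_mul_of_nonneg_right (mul_le_mul_of_nonneg_right
      (mul_le_mul_of_nonneg_left u1 (by norm_num)) hC) hC) hCs) (mul_le_mul_of_nonneg_left u2 hCCC)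
  have hθKl : 0 ≤ θK ^ l := pow_nonneg hθK0 l
  have hθSl : 0 ≤ θS ^ l := pow_nonneg hθS0 l
  have hA0 : 0 ≤ 3 * (cK * θK ^ l) * C * C * Cs + C * C * C * (cS * θS ^ l) :=
    add_nonneg (mul_nonneg (mul_nonneg (mul_nonneg (mul_nonneg (by norm_num) (mul_nonneg hcK hθKl)) hC) hC) hCs)
      (mul_nonneg hCCC (mul_nonneg hcS hθSl))
  have h2c : 0 ≤ 2 * |cout| := mul_nonneg (by norm_num) (abs_nonneg _)
  have h2c0 : 0 ≤ 2 * |cout| * c₀ := mul_nonneg h2c hc₀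
  have step : 2 * |cout| * |(sfStep Lc l * smStep d Lc l)⁻¹ * (cH l)⁻¹| * (3 * (cK * θK ^ l) * C * C * Cs + C * C * C * (cS * θS ^ l))
      ≤ 2 * |cout| * c₀ * (3 * (cK * (max θK θS) ^ l) * C * C * Cs + C * C * C * (cS * (max θK θS) ^ l)) :=
    mul_le_mul (mul_le_mul_of_nonneg_left hq' h2c) hA hA0 h2c0
  have hle : (2 * |cout| * |(sfStep Lc l * smStep d Lc l)⁻¹ * (cH l)⁻¹| * (3 * (cK * θK ^ l) * C * C * Cs + C * C * C * (cS * θS ^ l))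
      * ((Fintype.card (Fib d) : ℝ) * (Fintype.card (Fib d) : ℝ)
      * (2 * ((1 : ℝ) / 2 * (box (d + 1) Lc).card) * (((d + 1 : ℕ) : ℝ) * Zl (d + 1) (min δs δ / 2)) * Real.exp (min δs δ / 2 / 2 * (2 * (((d + 1 : ℕ) : ℝ) * Lc))))
      * Zl (d + 1) (min δs δ / 2 / 2 - min δs δ / 2 / 4) * Zl (d + 1) (min δs δ / 2 / 4 - min δs δ / 2 / 8)))
      ≤ (2 * |cout| * c₀ * (3 * cK * C * C * Cs + C * C * C * cS) * ((Fintype.card (Fib d) : ℝ) * (Fintype.card (Fib d) : ℝ)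
      * (2 * ((1 : ℝ) / 2 * (box (d + 1) Lc).card) * (((d + 1 : ℕ) : ℝ) * Zl (d + 1) (min δs δ / 2)) * Real.exp (min δs δ / 2 / 2 * (2 * (((d + 1 : ℕ) : ℝ) * Lc))))
      * Zl (d + 1) (min δs δ / 2 / 2 - min δs δ / 2 / 4) * Zl (d + 1) (min δs δ / 2 / 4 - min δs δ / 2 / 8))) * (max θK θS) ^ l :=
    calc (2 * |cout| * |(sfStep Lc l * smStep d Lc l)⁻¹ * (cH l)⁻¹| * (3 * (cK * θK ^ l) * C * C * Cs + C * C * C * (cS * θS ^ l))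
      * ((Fintype.card (Fib d) : ℝ) * (Fintype.card (Fib d) : ℝ)
      * (2 * ((1 : ℝ) / 2 * (box (d + 1) Lc).card) * (((d + 1 : ℕ) : ℝ) * Zl (d + 1) (min δs δ / 2)) * Real.exp (min δs δ / 2 / 2 * (2 * (((d + 1 : ℕ) : ℝ) * Lc))))
      * Zl (d + 1) (min δs δ / 2 / 2 - min δs δ / 2 / 4) * Zl (d + 1) (min δs δ / 2 / 4 - min δs δ / 2 / 8)))
        ≤ 2 * |cout| * c₀ * (3 * (cK * (max θK θS) ^ l) * C * C * Cs + C * C * C * (cS * (max θK θS) ^ l))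
      * ((Fintype.card (Fib d) : ℝ) * (Fintype.card (Fib d) : ℝ)
      * (2 * ((1 : ℝ) / 2 * (box (d + 1) Lc).card) * (((d + 1 : ℕ) : ℝ) * Zl (d + 1) (min δs δ / 2)) * Real.exp (min δs δ / 2 / 2 * (2 * (((d + 1 : ℕ) : ℝ) * Lc))))
      * Zl (d + 1) (min δs δ / 2 / 2 - min δs δ / 2 / 4) * Zl (d + 1) (min δs δ / 2 / 4 - min δs δ / 2 / 8)) := mul_le_mul_of_nonneg_right step hΨ0
      _ = (2 * |cout| * c₀ * (3 * cK * C * C * Cs + C * C * C * cS) * ((Fintype.card (Fib d) : ℝ) * (Fintype.card (Fib d) : ℝ)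
      * (2 * ((1 : ℝ) / 2 * (box (d + 1) Lc).card) * (((d + 1 : ℕ) : ℝ) * Zl (d + 1) (min δs δ / 2)) * Real.exp (min δs δ / 2 / 2 * (2 * (((d + 1 : ℕ) : ℝ) * Lc))))
      * Zl (d + 1) (min δs δ / 2 / 2 - min δs δ / 2 / 4) * Zl (d + 1) (min δs δ / 2 / 4 - min δs δ / 2 / 8))) * (max θK θS) ^ l := by ring
  have h := driftRows_level hLc hr cE cVH cΛ cout cH hq hG hGall hδ hS hSall hδs R R'' l
  exact ⟨locStencil₂_le_mono h.1 hle le_rfl, locStencil₂_le_mono h.2 hle le_rfl⟩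

/-! ## §2 `d = 3`, `Lc ≥ 2`, pin `cE = Lc⁴`: the drift rows for all levels, modulo the two scalar rows only -/

/-- NOT IN PRINT; OUR PROOF ATTEMPT ([folklore] composition: §1 ∘ road P1's `KSlotAssembly.convCKWall_holds` ⨾ asym1's `HessKerCoDressedBmWall.exists_coDressedBm_unit_rows` (the
dressed K uniform AND Cauchy rows) ∘ the OWNER gan24-p1 g22's `SrecAtSlotRowsFinal.exists_hS_hSall_SrecAt_three` ⨾ MY `WrecAtSlotRows.exists_spureRecAt_rows_three_of_srecAt_rows`
(«S′Shape» ∧ «S′Cauchy»)).  **THE DRIFT ROWS `hEd₁ ∕ hEd₂` AT `d = 3` FOR ALL LEVELS WITH ONE `(CEd, θE, δE)`, MODULO THE SCALAR ROWS `hcH`, `hq` ONLY** (`2 ≤ Lc`, pin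
`cE = Lc^{3+1}`, every `cVH cΛ cout`, every in-block root `r`, any residual letters `R l`, `R″ l`, any lock constants `cH l`).  The located row (ii′) of leaf-01 g72's A-5
(«the drift twin of p2's INTENT 2») for the whole tower: the S-slot input of the (α-END-b′) `hcelld` chain is discharged down to road P1's K-slot (shape AND rate) and the
OWNER's S-slot END.  Discharges NOTHING of `hcelld` ∕ `hcell` ∕ (Q-L) ∕ (C) ∕ «T2Drift^{ev}»; NEVER «G-an2-4 closed» as (CONV-C). -/
theorem exists_evenRowsDrift_uniform_three (hLc : 2 ≤ Lc) {cE : ℝ} (hcE : cE = (Lc : ℝ) ^ (3 + 1)) {r : Fin (3 + 1) → ℕ} (hr : r ∈ box (3 + 1) Lc)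
    (cVH cΛ cout : ℝ) (cH : ℕ → ℝ) {c₀ : ℝ} (hcH : ∀ l, |(sfStep Lc l * smStep 3 Lc l)⁻¹ * (cH l)⁻¹| ≤ c₀)
    (hq : ∀ l, (sfStep Lc (l + 1) * smStep 3 Lc (l + 1))⁻¹ * (cH (l + 1))⁻¹ = (sfStep Lc l * smStep 3 Lc l)⁻¹ * (cH l)⁻¹)
    (R R'' : ℕ → (Fin (3 + 1) → ℤ) → Fin (3 + 1) → (Fin (3 + 1) → ℤ) → MKer (3 + 1) (Fib 3)) :
    ∃ CEd θE δE : ℝ, 0 ≤ θE ∧ θE < 1 ∧ 0 < δE ∧ ∀ l,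
      LocStencil₂ (fun (_ : Fin (3 + 1)) (p : Fin (3 + 1) → ℤ) (κ' : Fin (3 + 1)) (u' : Fin (3 + 1) → ℤ) =>
            cout • (e3OfK Lc (unitK (sfStep Lc (l + 1)) (smStep 3 Lc (l + 1)) (coDressKBmAt (toSite r) Lc (KInvStep (d := 3) Lc (l + 1))))
                (fun κ' u' => (sfStep Lc (l + 1) * smStep 3 Lc (l + 1))⁻¹ • unitS (sfStep Lc (l + 1)) (smStep 3 Lc (l + 1))
                  (fun κ' u' => (cH (l + 1))⁻¹ • ((((1 : ℝ) + 1) / 2) • (comp (SpureRecAt 3 Lc (toSite r) cE cVH cΛ (l + 1) κ' u')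
                      (diagK (((1 : ℝ) / 2) • ∑ v ∈ box (3 + 1) Lc, legInd (toSite r) ((Lc : ℤ) • p + toSite v)))
                    - comp (diagK (((1 : ℝ) / 2) • ∑ v ∈ box (3 + 1) Lc, legInd (toSite r) ((Lc : ℤ) • p + toSite v)))
                      (SpureRecAt 3 Lc (toSite r) cE cVH cΛ (l + 1) κ' u')) + (((1 : ℝ) - 1) / 2) • R (l + 1) p κ' u')) κ' u') κ' u'
              + e3OfK Lc (unitK (sfStep Lc (l + 1)) (smStep 3 Lc (l + 1)) (coDressKBmAt (toSite r) Lc (KInvStep (d := 3) Lc (l + 1))))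
                (fun κ u => (sfStep Lc (l + 1) * smStep 3 Lc (l + 1))⁻¹ • unitS (sfStep Lc (l + 1)) (smStep 3 Lc (l + 1))
                  (fun κ u => (cH (l + 1))⁻¹ • ((((1 : ℝ) + 1) / 2) • (comp (SpureRecAt 3 Lc (toSite r) cE cVH cΛ (l + 1) κ u)
                      (diagK (((1 : ℝ) / 2) • ∑ v ∈ box (3 + 1) Lc, legInd (toSite r) ((Lc : ℤ) • p + toSite v)))
                    - comp (diagK (((1 : ℝ) / 2) • ∑ v ∈ box (3 + 1) Lc, legInd (toSite r) ((Lc : ℤ) • p + toSite v)))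
                      (SpureRecAt 3 Lc (toSite r) cE cVH cΛ (l + 1) κ u)) + (((1 : ℝ) - 1) / 2) • R'' (l + 1) p κ u)) κ u) κ' u')
        - (cout • (e3OfK Lc (unitK (sfStep Lc l) (smStep 3 Lc l) (coDressKBmAt (toSite r) Lc (KInvStep (d := 3) Lc l)))
              (fun κ' u' => (sfStep Lc l * smStep 3 Lc l)⁻¹ • unitS (sfStep Lc l) (smStep 3 Lc l)
                (fun κ' u' => (cH l)⁻¹ • ((((1 : ℝ) + 1) / 2) • (comp (SpureRecAt 3 Lc (toSite r) cE cVH cΛ l κ' u')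
                    (diagK (((1 : ℝ) / 2) • ∑ v ∈ box (3 + 1) Lc, legInd (toSite r) ((Lc : ℤ) • p + toSite v)))
                  - comp (diagK (((1 : ℝ) / 2) • ∑ v ∈ box (3 + 1) Lc, legInd (toSite r) ((Lc : ℤ) • p + toSite v)))
                    (SpureRecAt 3 Lc (toSite r) cE cVH cΛ l κ' u')) + (((1 : ℝ) - 1) / 2) • R l p κ' u')) κ' u') κ' u'
            + e3OfK Lc (unitK (sfStep Lc l) (smStep 3 Lc l) (coDressKBmAt (toSite r) Lc (KInvStep (d := 3) Lc l)))
              (fun κ u => (sfStep Lc l * smStep 3 Lc l)⁻¹ • unitS (sfStep Lc l) (smStep 3 Lc l)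
                (fun κ u => (cH l)⁻¹ • ((((1 : ℝ) + 1) / 2) • (comp (SpureRecAt 3 Lc (toSite r) cE cVH cΛ l κ u)
                    (diagK (((1 : ℝ) / 2) • ∑ v ∈ box (3 + 1) Lc, legInd (toSite r) ((Lc : ℤ) • p + toSite v)))
                  - comp (diagK (((1 : ℝ) / 2) • ∑ v ∈ box (3 + 1) Lc, legInd (toSite r) ((Lc : ℤ) • p + toSite v)))
                    (SpureRecAt 3 Lc (toSite r) cE cVH cΛ l κ u)) + (((1 : ℝ) - 1) / 2) • R'' l p κ u)) κ u) κ' u'))) (CEd * θE ^ l) δE ∧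
      LocStencil₂ (fun (κ : Fin (3 + 1)) (u : Fin (3 + 1) → ℤ) (_ : Fin (3 + 1)) (p : Fin (3 + 1) → ℤ) =>
            cout • (e3OfK Lc (unitK (sfStep Lc (l + 1)) (smStep 3 Lc (l + 1)) (coDressKBmAt (toSite r) Lc (KInvStep (d := 3) Lc (l + 1))))
                (fun κ' u' => (sfStep Lc (l + 1) * smStep 3 Lc (l + 1))⁻¹ • unitS (sfStep Lc (l + 1)) (smStep 3 Lc (l + 1))
                  (fun κ' u' => (cH (l + 1))⁻¹ • ((((1 : ℝ) + 1) / 2) • (comp (SpureRecAt 3 Lc (toSite r) cE cVH cΛ (l + 1) κ' u')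
                      (diagK (((1 : ℝ) / 2) • ∑ v ∈ box (3 + 1) Lc, legInd (toSite r) ((Lc : ℤ) • p + toSite v)))
                    - comp (diagK (((1 : ℝ) / 2) • ∑ v ∈ box (3 + 1) Lc, legInd (toSite r) ((Lc : ℤ) • p + toSite v)))
                      (SpureRecAt 3 Lc (toSite r) cE cVH cΛ (l + 1) κ' u')) + (((1 : ℝ) - 1) / 2) • R (l + 1) p κ' u')) κ' u') κ u
              + e3OfK Lc (unitK (sfStep Lc (l + 1)) (smStep 3 Lc (l + 1)) (coDressKBmAt (toSite r) Lc (KInvStep (d := 3) Lc (l + 1))))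
                (fun κ u => (sfStep Lc (l + 1) * smStep 3 Lc (l + 1))⁻¹ • unitS (sfStep Lc (l + 1)) (smStep 3 Lc (l + 1))
                  (fun κ u => (cH (l + 1))⁻¹ • ((((1 : ℝ) + 1) / 2) • (comp (SpureRecAt 3 Lc (toSite r) cE cVH cΛ (l + 1) κ u)
                      (diagK (((1 : ℝ) / 2) • ∑ v ∈ box (3 + 1) Lc, legInd (toSite r) ((Lc : ℤ) • p + toSite v)))
                    - comp (diagK (((1 : ℝ) / 2) • ∑ v ∈ box (3 + 1) Lc, legInd (toSite r) ((Lc : ℤ) • p + toSite v)))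
                      (SpureRecAt 3 Lc (toSite r) cE cVH cΛ (l + 1) κ u)) + (((1 : ℝ) - 1) / 2) • R'' (l + 1) p κ u)) κ u) κ u)
        - (cout • (e3OfK Lc (unitK (sfStep Lc l) (smStep 3 Lc l) (coDressKBmAt (toSite r) Lc (KInvStep (d := 3) Lc l)))
              (fun κ' u' => (sfStep Lc l * smStep 3 Lc l)⁻¹ • unitS (sfStep Lc l) (smStep 3 Lc l)
                (fun κ' u' => (cH l)⁻¹ • ((((1 : ℝ) + 1) / 2) • (comp (SpureRecAt 3 Lc (toSite r) cE cVH cΛ l κ' u')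
                    (diagK (((1 : ℝ) / 2) • ∑ v ∈ box (3 + 1) Lc, legInd (toSite r) ((Lc : ℤ) • p + toSite v)))
                  - comp (diagK (((1 : ℝ) / 2) • ∑ v ∈ box (3 + 1) Lc, legInd (toSite r) ((Lc : ℤ) • p + toSite v)))
                    (SpureRecAt 3 Lc (toSite r) cE cVH cΛ l κ' u')) + (((1 : ℝ) - 1) / 2) • R l p κ' u')) κ' u') κ u
            + e3OfK Lc (unitK (sfStep Lc l) (smStep 3 Lc l) (coDressKBmAt (toSite r) Lc (KInvStep (d := 3) Lc l)))
              (fun κ u => (sfStep Lc l * smStep 3 Lc l)⁻¹ • unitS (sfStep Lc l) (smStep 3 Lc l)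
                (fun κ u => (cH l)⁻¹ • ((((1 : ℝ) + 1) / 2) • (comp (SpureRecAt 3 Lc (toSite r) cE cVH cΛ l κ u)
                    (diagK (((1 : ℝ) / 2) • ∑ v ∈ box (3 + 1) Lc, legInd (toSite r) ((Lc : ℤ) • p + toSite v)))
                  - comp (diagK (((1 : ℝ) / 2) • ∑ v ∈ box (3 + 1) Lc, legInd (toSite r) ((Lc : ℤ) • p + toSite v)))
                    (SpureRecAt 3 Lc (toSite r) cE cVH cΛ l κ u)) + (((1 : ℝ) - 1) / 2) • R'' l p κ u)) κ u) κ u))) (CEd * θE ^ l) δE := by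
  have hLc1 : 1 ≤ Lc := by omega
  obtain ⟨C, δK, cK, θK, hδK, hθK0, hθK1, hK, hKall⟩ := convCKWall_holds (Lc := Lc) hLc
  obtain ⟨c, -, hG, hGall⟩ := exists_coDressedBm_unit_rows hLc1 hr (sfStep Lc) (smStep 3 Lc) sfStep_ne_zero smStep_ne_zero
    (K := fun j => KInvStep (d := 3) Lc j) hδK hK hKall
  obtain ⟨Cs, cS, θS, δS, hθS0, hθS1, hδS, hall⟩ := exists_hS_hSall_SrecAt_three hLc hcE cVH cΛ
  obtain ⟨hS, hSall⟩ := hall r hr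
  obtain ⟨Cs', cS', θ', δ', hθ'0, hθ'1, hδ', hS', hS'all⟩ := exists_spureRecAt_rows_three_of_srecAt_rows hLc hr cE cVH cΛ hS hSall hδS hθS0 hθS1
  exact exists_evenRowsDrift_uniform_of_rows hLc1 hr cE cVH cΛ cout cH hcH hq hG hGall (by positivity) hθK0 hθK1 hS' hS'all hδ' hθ'0 hθ'1 R R''

end Levels

end Summit.QuantumFields.BalabanUV.Beta.GAN24.BlockCommutatorStepLetterDrift

end
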